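import Literature.AlgebraicGeometry.Resolution.KnafKuhlmann2009Thm11
import Literature.AlgebraicGeometry.Resolution.AbhyankarEtaleAscent
import HarnessLib

/-!
# The frontier of `KnafKuhlmann2009`: Prop. 3.10 (henselian rationality) and KK05 Thm. 3.4 (inertial generation)

Topic: `Literature/AlgebraicGeometry/Resolution`. Bookkeeping corollaries combining
`KnafKuhlmann2009Thm11.lean` (`KnafKuhlmann2009_Thm11.of_prop310`: Knaf–Kuhlmann 2009, Thm. 1.1
from Prop. 3.10 over separably closed ground fields) with `AbhyankarEtaleAscent.lean`
(`KnafKuhlmann2009.of_parts''`: the fact `KnafKuhlmann2009` from KK09 Thm. 1.1 and KK05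
Thm. 3.4): the named fact `KnafKuhlmann2009` (Knaf–Kuhlmann 2009, Thm. 1.2, weak regular-centre
form of `LocalUniformization.lean`) and the printed Thm. 1.2 (`KnafKuhlmann2009_Thm12`,
`SmoothUniformization.lean`) follow from exactly two named facts,

* `KnafKuhlmann2009_Prop310_sepClosed` (`KnafKuhlmann2009Thm11Parts.lean`) — KK09 Prop. 3.10 over
  a separable-algebraically closed ground field: an immediate separable function field of
  transcendence degree `1` over `(K^{sep}, 𝓟)` is strongly smoothly `O_{K^{sep}}`-uniformizable
  (F.-V. Kuhlmann's henselian rationality, [K8] = Israel J. Math. 234 (2019), + Kaplansky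
  approximation + the étale-local structure Lemma 3.7);
* `KnafKuhlmann2005_Thm34_etale` (`AbhyankarEtaleAscent.lean`) — KK05 Thm. 3.4 in the
  standard-étale form of KK05 §5: a `K`-trivial Abhyankar place with separable residue field
  extension is inertially generated (the Generalized Stability Theorem, Kuhlmann 2010, + [Ray] X
  Thm. 1),

all other steps of the printed proofs of KK09 Thm. 1.2, Thm. 1.1, Prop. 2.3, Prop. 3.2,
Prop. 3.4 (2), Lemma 2.1, Lemma 3.9 and of KK05 Thm. 1.1 (§§4–5), Thm. 2.1, Cor. 2.2 being
theorems of this topic.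

## Sources

* H. Knaf, F.-V. Kuhlmann, *Every place admits local uniformization in a finite extension of the
  function field*, Adv. Math. 221 (2009) 428–453 = arXiv:math/0702856, Thm. 1.1, Thm. 1.2,
  Prop. 3.10, §4.
* H. Knaf, F.-V. Kuhlmann, *Abhyankar places admit local uniformization in any characteristic*,
  Ann. Sci. ÉNS 38 (2005) 833–846 = arXiv:math/0304159, Thm. 1.1, Thm. 3.4, §5.
-/

noncomputable section

namespace Literature.AlgebraicGeometry.Resolution

universe u

/-- **Knaf–Kuhlmann 2009, Thm. 1.2 (as printed, first paragraph) from Prop. 3.10 and KK05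
Thm. 3.4.** [cite: KnafKuhlmann2009, Thm. 1.2] -/
theorem KnafKuhlmann2009_Thm12.of_prop310 (h310 : KnafKuhlmann2009_Prop310_sepClosed.{u})
    (h34 : KnafKuhlmann2005_Thm34_etale.{u}) : KnafKuhlmann2009_Thm12.{u} :=
  KnafKuhlmann2009_Thm12.of_parts'' (KnafKuhlmann2009_Thm11.of_prop310 h310) h34

/-- **The named fact `KnafKuhlmann2009` from Prop. 3.10 and KK05 Thm. 3.4**: its trust base is
now exactly `{KnafKuhlmann2009_Prop310_sepClosed, KnafKuhlmann2005_Thm34_etale}`.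
[cite: KnafKuhlmann2009, Thm. 1.2] -/
theorem KnafKuhlmann2009.of_prop310 (h310 : KnafKuhlmann2009_Prop310_sepClosed.{u})
    (h34 : KnafKuhlmann2005_Thm34_etale.{u}) : KnafKuhlmann2009.{u} :=
  KnafKuhlmann2009.of_parts'' (KnafKuhlmann2009_Thm11.of_prop310 h310) h34

end Literature.AlgebraicGeometry.Resolution

end
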